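import Summits.QuantumFields.YangMills.Theorems.FluctuationComparisonRegPrIntLS2BetaChartReadDerivCovLinAvg
import Literature.MathematicalPhysics.QuantumFieldTheory.Balaban1983to89.B12B0LoopGeometry267
import HarnessLib

/-!
# S2β · (D1-loc) THE ONE-STEP DERIVATIVE AND THE LINEARISED AVERAGE ARE BLOCK-LOCAL; THE PER-COARSE-BOND LOCAL-SUP FORM OF (D1)
# «`‖((Dψ_{U₀} X) c) − (Q₁^{R₀}(U₀) X̂) c‖ ≤ 404·ℓ·α·max_{b ∈ blocks(c)} ‖X b‖`» (px16 g21's currency for RINV-cov, bus 13:30:58Z)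

Cell `ym3-torus` (YM ladder rung R3 = continuum `SU(2)` Yang–Mills on the three-torus at fixed lattice data — a RUNG: NOT d = 4, NOT infinite volume, NOT a mass gap,
NOT Clay).  Width seat `ym3-torus-px13` (gen 25); crux `stmt-QuantumFields-20520`, LINE g18-1 S2β, letter MULT♮ ⟸ (RINV-curl) ∧ BKG (✓p824141), (RINV-curl) ⟸ RINV-cov (px16 g21's
pen: covariant column spread + Neumann inversion + curl count) over THIS lineage's action bricks (D0) ✓`…ChartReadDescentChainRule`, (D1) ✓`…ChartReadDerivCovLinAvg`.  THIS FILE: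
the LOCALITY half — `--kind proof --supports stmt-QuantumFields-20520 --as helper`, count-neutral, DEFINITION-FREE (0 `def`, 0 `instance`, 0 `notation`, 0 `sorry`).

WHAT IS PROVED (sorry-free; generic `P : Params`, `SU(N)`, level `j`, standing range `j + 1 ≤ m + K` where the lattice geometry needs it).
* §1 `covWalkSum_congr` — the covariant signed sum along `γ` reads the bond field only on the bonds of `γ`; `covLinAvgR0_local` — **`(Q₁^{R₀}(U₀) Y)(c) = (Q₁^{R₀}(U₀) Y′)(c)`
  whenever `Y = Y′` on the bonds issuing from `B(c₋) ∪ B(c₊)`** (staircases stay in their block, lit `B12B0LoopGeometry267.stair_src_tgt_blockOf`; the straight segment's bonds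
  issue from `B(c₋)` then `B(c₊)`, lit `blockOf_shiftN_blockSite_of_le∕_ge` with `walkEnd_emb_stairWord_eq_blockSite`).
* §2 `chartRead_apply_local` — `ψ_{U₀}(A)(c) = ψ_{U₀}(A′)(c)` whenever `A = A′` on those bonds (lit `BlockAveraging.avgFun_local`); ★`fderiv_chartRead_apply_local` — hence
  **`(Dψ_{U₀}(0) X) c = (Dψ_{U₀}(0) X′) c`** for `X = X′` there (the ray derivatives of equal functions, (D0) `hasDerivAt_chartRead_avgFun_ray`, `HasDerivAt.unique`).
* §3 ★★★`norm_fderiv_chartRead_sub_covLinAvgR0_le_local` — **`‖↑((Dψ_{U₀}(0) X) c) − (Q₁^{R₀}(U₀) X̂)(c)‖ ≤ 404·ℓ·α·‖X^{(c)}‖`**, `X^{(c)} b := if blockOf b.src ∈ {c₋, c₊} then X b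
  else 0` the block truncation (so `‖X^{(c)}‖ = max_{b ∈ blocks(c)} ‖X b‖`): (D1) applied to `X^{(c)}`, both sides unchanged by §1–§2.

HONEST.  Lattice bookkeeping over (D1); nothing of Bałaban's; RINV-cov ∕ (RINV-curl) ∕ MULT♮ ∕ AVG₂♭ ∕ «CRIT-ax» ∕ (D-ax) ∕ GAP♯∘ (registry UNTOUCHED) ∕ the five REGISTERED stubs ∕ S2β ∕
crux 20520 ∕ 19936 ∕ 19200 ∕ `YM3TorusSU2` NOT proved; no summit statement is proved by a helper; rung R3 = SU(2) YM₃ on T³ at fixed lattice data — NOT d = 4, NOT infinite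
volume, NOT a mass gap, NOT Clay; the Yang–Mills mass gap is NOT proved.  Axioms standard.

References: T. Bałaban, CMP **98** (1985) 17–51 [Balaban1985Averaging] (p.19: locality of the averaging; Prop. 3 (121)–(126) p.36); CMP **109** (1987) 249–301 [Balaban1987RG1]
((0.3)–(0.4) pp.252–253: blocks, staircases, the straight segment).
-/

set_option autoImplicit false

noncomputable section

open scoped Matrix.Norms.L2Operator Topology
open Filter Set Function

namespace Summit.QuantumFields.YangMills.Theorems.FluctuationComparisonRegPrIntLS2BetaChartReadDerivLocal

open Literature.MathematicalPhysics.QuantumFieldTheory.Balaban1983to89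
open Literature.MathematicalPhysics.QuantumFieldTheory.Balaban1983to89.T4Continuum
open Literature.MathematicalPhysics.QuantumFieldTheory.Balaban1983to89.HaarExponentialChart
open Literature.MathematicalPhysics.QuantumFieldTheory.Balaban1983to89.HaarExponentialChart.IsChartRep
open Literature.MathematicalPhysics.QuantumFieldTheory.Balaban1983to89.BlockAveraging
open Literature.MathematicalPhysics.QuantumFieldTheory.Balaban1983to89.ExpMeanLog (expMeanLogSU deltaSU)
open Literature.MathematicalPhysics.QuantumFieldTheory.Balaban1983to89.Node00
open Literature.MathematicalPhysics.QuantumFieldTheory.Balaban1983to89.BlockAveragingEMLLinearisedBackground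
  (pertVar covStep covWalkSum covWalkSum_cons covLinAvgR0 norm_avgFun_ratio_sub_one_sub_covLinAvgR0_le)
open Literature.MathematicalPhysics.QuantumFieldTheory.Balaban1983to89.B12B0LoopGeometry267
  (stair_src_tgt_blockOf mem_walk_replicate_true blockOf_shiftN_blockSite_of_le blockOf_shiftN_blockSite_of_ge)
open Literature.MathematicalPhysics.QuantumFieldTheory.Balaban1983to89.BlockAveragingEMLLinearised (walkEnd_emb_stairWord_eq_blockSite)
open Summit.QuantumFields.YangMills.BalabanUVNodes.N09ChartReadAveragingSmooth
open Summit.QuantumFields.YangMills.Theorems.FluctuationComparisonRegPrIntLS2BetaChartReadDescentChainRule (hasDerivAt_chartRead_avgFun_ray)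
open Summit.QuantumFields.YangMills.Theorems.FluctuationComparisonRegPrIntLS2BetaChartReadDerivCovLinAvg (norm_fderiv_chartRead_sub_covLinAvgR0_le)

variable {P : Params} {N : ℕ} [NeZero N] {j : ℕ}

/-! ## §1 Locality of the covariant signed sum and of `Q₁^{R₀}(U₀)` -/

section LinLocal

omit [NeZero N] in
/-- The covariant signed sum along `γ` reads the bond field only on the bonds of `γ`. [cite: Balaban1985Averaging, (58) p.27 (bookkeeping)] -/
theorem covWalkSum_congr (U₀ : GaugeField P j (SU N)) {Y Y' : PBond P j → Matrix (Fin N) (Fin N) ℂ} :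
    ∀ γ : List (LStep P j), (∀ s ∈ γ, Y s.bond = Y' s.bond) → covWalkSum U₀ Y γ = covWalkSum U₀ Y' γ
  | [], _ => rfl
  | s :: γ, h => by
    rw [covWalkSum_cons, covWalkSum_cons, covWalkSum_congr U₀ γ (fun s' hs' => h s' (List.mem_cons_of_mem s hs'))]
    have hs : Y s.bond = Y' s.bond := h s List.mem_cons_self
    unfold covStep
    rw [hs]

/-- The bonds of the straight segment `[x_i, x_i′]` (`L` steps `+e_μ` from the block site `x_i = blockSite c₋ r`) issue from `B(c₋)` or `B(c₊)` (standing range).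
[cite: Balaban1987RG1, (0.3) p.252; Balaban1985Averaging, (9) p.19] -/
theorem blockOf_src_of_mem_line (hj : j + 1 ≤ P.m + P.K) (c : PBond P (j + 1)) (σ : Equiv.Perm (Fin P.d)) (r : Fin P.d → Fin P.L) (s : LStep P j)
    (hs : s ∈ walk (walkEnd (emb c.src) (stairWord σ (off r))) (List.replicate P.L (c.dir, true))) :
    blockOf s.bond.src = c.src ∨ blockOf s.bond.src = c.tgt := by
  rw [walkEnd_emb_stairWord_eq_blockSite] at hs
  obtain ⟨t, ht, rfl⟩ := (mem_walk_replicate_true _ _ _ s).1 hs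
  by_cases hle : (r c.dir : ℕ) + t ≤ P.L - 1
  · left; exact blockOf_shiftN_blockSite_of_le hj c r t hle
  · right; exact blockOf_shiftN_blockSite_of_ge hj c r t (by omega) ht.le

/-- **`Q₁^{R₀}(U₀)` IS BLOCK-LOCAL**: `(Q₁^{R₀}(U₀) Y)(c)` depends on `Y` only through the bonds issuing from `B(c₋) ∪ B(c₊)` (staircases from `emb c₋`, `emb c₊` stay in their blocks; the
straight segment crosses from `B(c₋)` to `B(c₊)`). [cite: Balaban1985Averaging, (124)-(125) p.36, p.19] -/
theorem covLinAvgR0_local (hj : j + 1 ≤ P.m + P.K) (U₀ : GaugeField P j (SU N)) {Y Y' : PBond P j → Matrix (Fin N) (Fin N) ℂ} (c : PBond P (j + 1))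
    (h : ∀ b : PBond P j, (blockOf b.src = c.src ∨ blockOf b.src = c.tgt) → Y b = Y' b) :
    covLinAvgR0 U₀ Y c = covLinAvgR0 U₀ Y' c := by
  have hst : ∀ i : Idx P, covWalkSum U₀ Y (walk (emb c.src) (stairWord i.2.1 (off i.1))) = covWalkSum U₀ Y' (walk (emb c.src) (stairWord i.2.1 (off i.1))) :=
    fun i => covWalkSum_congr U₀ _ fun s hs => h s.bond (Or.inl (stair_src_tgt_blockOf hj c.src i.2.1 i.1 s hs).1)
  have hst' : ∀ i : Idx P, covWalkSum U₀ Y (walk (emb c.tgt) (stairWord i.2.2 (off i.1))) = covWalkSum U₀ Y' (walk (emb c.tgt) (stairWord i.2.2 (off i.1))) :=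
    fun i => covWalkSum_congr U₀ _ fun s hs => h s.bond (Or.inr (stair_src_tgt_blockOf hj c.tgt i.2.2 i.1 s hs).1)
  have hline : ∀ i : Idx P, covWalkSum U₀ Y (walk (walkEnd (emb c.src) (stairWord i.2.1 (off i.1))) (List.replicate P.L (c.dir, true))) =
      covWalkSum U₀ Y' (walk (walkEnd (emb c.src) (stairWord i.2.1 (off i.1))) (List.replicate P.L (c.dir, true))) :=
    fun i => covWalkSum_congr U₀ _ fun s hs => h s.bond (blockOf_src_of_mem_line hj c i.2.1 i.1 s hs)
  unfold covLinAvgR0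
  simp only [hst, hst', hline]

end LinLocal

/-! ## §2 Locality of the chart-read average and of its derivative -/

section ChartLocal

/-- The chart-read average at `c` reads the chart coordinate only on the bonds issuing from `B(c₋) ∪ B(c₊)` (lit `avgFun_local` twice). [cite: Balaban1985Averaging, p.19] -/
theorem chartRead_apply_local (hj : j + 1 ≤ P.m + P.K) (U₀ : GaugeField P j (SU N)) {A A' : PBond P j → (specialUnitaryLogChart (Fin N)).lie} (c : PBond P (j + 1))
    (h : ∀ b : PBond P j, (blockOf b.src = c.src ∨ blockOf b.src = c.tgt) → A b = A' b) :
    (isChartRep_specialUnitaryGroup (n := Fin N)).logChart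
        (avgFun (expMeanLogSU (n := Fin N)) (fun b => (isChartRep_specialUnitaryGroup (n := Fin N)).expChart (A b) * U₀ b) c *
          (avgFun (expMeanLogSU (n := Fin N)) U₀ c)⁻¹) =
      (isChartRep_specialUnitaryGroup (n := Fin N)).logChart
        (avgFun (expMeanLogSU (n := Fin N)) (fun b => (isChartRep_specialUnitaryGroup (n := Fin N)).expChart (A' b) * U₀ b) c *
          (avgFun (expMeanLogSU (n := Fin N)) U₀ c)⁻¹) := by
  rw [avgFun_local (expMeanLogSU (n := Fin N)) hj (fun b => (isChartRep_specialUnitaryGroup (n := Fin N)).expChart (A b) * U₀ b)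
    (fun b => (isChartRep_specialUnitaryGroup (n := Fin N)).expChart (A' b) * U₀ b) c (fun b hb => by simp only [h b hb])]

/-- ★ **THE ONE-STEP DERIVATIVE IS BLOCK-LOCAL**: `(Dψ_{U₀}(0) X) c = (Dψ_{U₀}(0) X′) c` whenever `X = X′` on the bonds issuing from `B(c₋) ∪ B(c₊)` (guard at `U₀`; the two ray
functions `t ↦ ψ(tX) c`, `t ↦ ψ(tX′) c` coincide, so do their derivatives at `0`). [cite: Balaban1985Averaging, p.19, Prop. 3 (122) p.36] -/
theorem fderiv_chartRead_apply_local (hj : j + 1 ≤ P.m + P.K) (U₀ : GaugeField P j (SU N)) (hsmall : ∀ c, Small (expMeanLogSU (n := Fin N)) U₀ c)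
    {X X' : PBond P j → (specialUnitaryLogChart (Fin N)).lie} (c : PBond P (j + 1))
    (h : ∀ b : PBond P j, (blockOf b.src = c.src ∨ blockOf b.src = c.tgt) → X b = X' b) :
    fderiv ℝ (fun (A : PBond P j → (specialUnitaryLogChart (Fin N)).lie) (c : PBond P (j + 1)) =>
        (isChartRep_specialUnitaryGroup (n := Fin N)).logChart
          (avgFun (expMeanLogSU (n := Fin N)) (fun b => (isChartRep_specialUnitaryGroup (n := Fin N)).expChart (A b) * U₀ b) c *
            (avgFun (expMeanLogSU (n := Fin N)) U₀ c)⁻¹)) 0 X c =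
      fderiv ℝ (fun (A : PBond P j → (specialUnitaryLogChart (Fin N)).lie) (c : PBond P (j + 1)) =>
        (isChartRep_specialUnitaryGroup (n := Fin N)).logChart
          (avgFun (expMeanLogSU (n := Fin N)) (fun b => (isChartRep_specialUnitaryGroup (n := Fin N)).expChart (A b) * U₀ b) c *
            (avgFun (expMeanLogSU (n := Fin N)) U₀ c)⁻¹)) 0 X' c := by
  have hX := (hasDerivAt_pi.1 (hasDerivAt_chartRead_avgFun_ray (P := P) (N := N) U₀ hsmall X)) c
  have hX' := (hasDerivAt_pi.1 (hasDerivAt_chartRead_avgFun_ray (P := P) (N := N) U₀ hsmall X')) c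
  have heq : (fun t : ℝ => (fun (A : PBond P j → (specialUnitaryLogChart (Fin N)).lie) (c : PBond P (j + 1)) =>
        (isChartRep_specialUnitaryGroup (n := Fin N)).logChart
          (avgFun (expMeanLogSU (n := Fin N)) (fun b => (isChartRep_specialUnitaryGroup (n := Fin N)).expChart (A b) * U₀ b) c *
            (avgFun (expMeanLogSU (n := Fin N)) U₀ c)⁻¹)) (t • X) c) =
      (fun t : ℝ => (fun (A : PBond P j → (specialUnitaryLogChart (Fin N)).lie) (c : PBond P (j + 1)) =>
        (isChartRep_specialUnitaryGroup (n := Fin N)).logChart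
          (avgFun (expMeanLogSU (n := Fin N)) (fun b => (isChartRep_specialUnitaryGroup (n := Fin N)).expChart (A b) * U₀ b) c *
            (avgFun (expMeanLogSU (n := Fin N)) U₀ c)⁻¹)) (t • X') c) := by
    funext t
    exact chartRead_apply_local (P := P) (N := N) hj U₀ c (fun b hb => by simp only [Pi.smul_apply, h b hb])
  rw [heq] at hX
  exact hX.unique hX'

end ChartLocal

/-! ## §3 The per-coarse-bond local-sup form of (D1) -/

section LocalSup

/-- ★★★ **(D1), LOCAL-SUP FORM**: for `U₀` in the loop `α`-guard (`α ≤ 1∕24`, `α < δ_N`), standing range `j + 1 ≤ m + K`, every direction `X` and coarse bond `c`: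
`‖↑((Dψ_{U₀}(0) X) c) − (Q₁^{R₀}(U₀) X̂)(c)‖ ≤ 404·ℓ·α·‖X^{(c)}‖` with `X^{(c)}` the truncation of `X` to the bonds issuing from `B(c₋) ∪ B(c₊)` — so the right side is
`404·ℓ·α·max_{b ∈ blocks(c)} ‖X b‖`, and `(Dψ X) c`, `(Q₁^{R₀} X̂) c` read `X` only there. [cite: Balaban1985Averaging, Prop. 3 (121)-(126) p.36, p.19] -/
theorem norm_fderiv_chartRead_sub_covLinAvgR0_le_local (hj : j + 1 ≤ P.m + P.K) (U₀ : GaugeField P j (SU N)) {α : ℝ}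
    (hα : ∀ c i, dist1 (loopHol U₀ c i) ≤ α) (hα24 : α ≤ 1 / 24) (hαδ : α < deltaSU (Fin N))
    (X : PBond P j → (specialUnitaryLogChart (Fin N)).lie) (c : PBond P (j + 1)) :
    ‖((fderiv ℝ (fun (A : PBond P j → (specialUnitaryLogChart (Fin N)).lie) (c : PBond P (j + 1)) =>
          (isChartRep_specialUnitaryGroup (n := Fin N)).logChart
            (avgFun (expMeanLogSU (n := Fin N)) (fun b => (isChartRep_specialUnitaryGroup (n := Fin N)).expChart (A b) * U₀ b) c *
              (avgFun (expMeanLogSU (n := Fin N)) U₀ c)⁻¹)) 0 X c : (specialUnitaryLogChart (Fin N)).lie) : Matrix (Fin N) (Fin N) ℂ) -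
        covLinAvgR0 U₀ (fun b => ((X b : (specialUnitaryLogChart (Fin N)).lie) : Matrix (Fin N) (Fin N) ℂ)) c‖ ≤
      404 * (((P.d + 2) * P.L : ℕ) : ℝ) * α *
        ‖(fun b : PBond P j => if blockOf b.src = c.src ∨ blockOf b.src = c.tgt then X b else 0)‖ := by
  classical
  have hsmall : ∀ c, Small (expMeanLogSU (n := Fin N)) U₀ c := fun c i => lt_of_le_of_lt (hα c i) hαδ
  set Xc : PBond P j → (specialUnitaryLogChart (Fin N)).lie := fun b => if blockOf b.src = c.src ∨ blockOf b.src = c.tgt then X b else 0 with hXc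
  have hagree : ∀ b : PBond P j, (blockOf b.src = c.src ∨ blockOf b.src = c.tgt) → X b = Xc b := fun b hb => by
    simp only [hXc, hb, if_true]
  have hD := fderiv_chartRead_apply_local (P := P) (N := N) hj U₀ hsmall c hagree
  have hQ : covLinAvgR0 U₀ (fun b => ((X b : (specialUnitaryLogChart (Fin N)).lie) : Matrix (Fin N) (Fin N) ℂ)) c =
      covLinAvgR0 U₀ (fun b => ((Xc b : (specialUnitaryLogChart (Fin N)).lie) : Matrix (Fin N) (Fin N) ℂ)) c :=
    covLinAvgR0_local (P := P) (N := N) hj U₀ c fun b hb => by rw [hagree b hb]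
  rw [hD, hQ]
  exact norm_fderiv_chartRead_sub_covLinAvgR0_le (P := P) (N := N) U₀ hα hα24 hαδ Xc c

end LocalSup

end Summit.QuantumFields.YangMills.Theorems.FluctuationComparisonRegPrIntLS2BetaChartReadDerivLocal

end
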